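import Summits.QuantumFields.YangMills.Theorems.UnitScaleTiltProp7FrameLevelOnto
import HarnessLib

/-!
# Route `UnitScaleTilt`, crux K1 child «MinimiserStabilityRegPr» (stmt-QuantumFields-19200), skeleton v10, stub `stub_existenceMinimalOrbit` (EX), route (α) —
# **(R2t, FILE A1) THE FRAME-CORRECTED GAUGE OPERATOR MINUS THE NESTED COVARIANT MEAN: ONE LEVEL** (plan v2 row R2t = the transfer-smallness input `hKT` of ★w5-20520 g7's
# «R2b″ ROWS ASSEMBLER» `Prop7LandauTransversalityPairing.hS_of_rowsZ`; LOCATE memo `pub/ym3-torus/ym3-torus-px6/LOCATE-R2t-px6g2.md`).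

Cell `ym3-torus`, width seat `ym3-torus-px6` (gen 2).  THEOREMS ONLY (0 `def`, 0 `sorry`).  `--supports stmt-QuantumFields-19200 --as helper`, count-neutral.  YM₃ on T³ is a ladder
rung (R3), not the Clay problem; nothing here claims the stub, the crux, d = 4 or the mass gap.

THE POINT.  The frame-corrected gauge operator of T5-A (✓`Prop7FrameLevelOnto.exists_frameCorrected_eq`), `𝓚_{A₁}N(x) = N(x̂⁽ᵏ⁾x) − V_k(x)·ν_k(x)⁻¹` (`V_k` the derivative of the
accumulated frames `frameAccU k U₀ (U′^{g_t})`, `ν_k = frameAccU k U₀ U′`), obeys by FR₁ §4 (✓`hasDerivAt_frameAccU_succ_at`) the EXACT one-level identity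
`ρ_{j+1}(y) = mean_i Ad_{Q_{y,i}} ρ_j(x_{y,i}) − Ad_{ν_j(ŷ)}(E_y·w_j(y)⁻¹)`, `Q_{y,i} = ν_j(ŷ)·D̄_j(Γ_{y,i})·ν_j(x_{y,i})⁻¹`, with FR₁ §5's defect `E_y = D eml(τ)(σ·τ) − (mean σ)·eml τ`
(`‖E_y‖ ≤ 163‖σ‖_∞‖τ − 1‖`, ✓`norm_fderiv_eml_mul_sub_mean_mul_le`), while its background value `𝓚₀N = ns` (the averaging sequence of ✓`QTwS_gaugeDir_of_avgSeq`, cf.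
✓`hasDerivAt_frameAccU_of_avgSeq` with ✓`frameAccU_self`) obeys `ns_{j+1}(y) = mean_i Ad_{Ū₀⁽ʲ⁾(Γ_{y,i})} ns_j(x_{y,i})`.  This file proves the ONE-LEVEL comparison abstractly (§2:
any index set, contractive units, `‖P_i − Q₀_i‖ ≤ δP`, `‖ν − 1‖ ≤ δν`, `‖τ − 1‖ ≤ δτ ≤ 1∕24`) with the bound
**`mean_i ‖b_i − b₀_i‖ + 2(2δν + δP)·mean_i ‖b_i‖ + 326·A·δτ`** (`A` a common bound of the centre and child values — the located `L^{d∕2}` sampling loss of the sequel), and the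
domination `‖ns_j‖ ≤ R_j` of the nested covariant mean by any super-averaging block majorant (§3).  The tower induction and the T³ member are the sequels
(`…FrameCorrectedMinusMeanLevel`, `…FrameCorrectedMinusMeanL2`).  NO loop letter and NO smoothness of `N` enter.

WHAT IS PROVED (sorry-free, no definition, any complete normed `ℂ`-algebra `𝔸`): §1 `norm_conj_le_of_norm_le_one`, `norm_conj_sub_conj_le_of_norm_le_one`, `norm_frame_mul_mul_inv_sub_le`,
`norm_meanCLM_le_mean_norm`; §2 ★★`norm_levelStep_sub_mean_le`; §3 `avgSeq_succ_eq_mean`, ★`norm_avgSeq_le_majorant`.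
HONEST SCOPE: normed-algebra bookkeeping around FR₁'s displayed successor and FR₁ §5; constants explicit and crude; nothing of print is asserted.

References: T. Bałaban, CMP 98 (1985) 17–51 [Balaban1985Averaging] ((58) p.27, (82) p.30, (89)–(92) p.31, (97) p.32, (19) p.21); CMP 95 (1984) 17–40 [Balaban1984PropagatorsI]
((1.16)–(1.18) p.20); CMP 99 (1985) 389–434 [Balaban1985BackgroundPropagators] ((3.19) p.393, (3.21) p.394); CMP 109 (1987) 249–301 [Balaban1987RG1] ((0.3)–(0.4) pp.252–253).
-/

set_option autoImplicit false

noncomputable section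

open scoped BigOperators Topology
open Filter NormedSpace Metric

namespace Summit.QuantumFields.YangMills.Theorems.Prop7FrameCorrectedMinusMean

open Literature.MathematicalPhysics.QuantumFieldTheory.Balaban1983to89
open T4Continuum BlockAveraging ExpMeanLog MatrixLog
open B10Eq27TorusAxialLog (holT gaugeActT gaugeActT_apply transl)
open B7Prop1Explicit (expUnit val_expUnit disp)
open B7TransferAnalyticMean (meanCLM meanCLM_apply norm_meanCLM_apply_le)
open Summit.QuantumFields.YangMills.Theorems.Prop7SymAvgTwSym (tstairU tstairU_def vframeCovU coe_vframeCovU dbarCovIterU frameAccU frameAccU_succ frameAccU_zero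
  frameAccU_self dbarCovIterU_self)
open Summit.QuantumFields.YangMills.Theorems.Prop7SymFrameGaugeResponseAt (hasDerivAt_frameAccU_succ_at norm_fderiv_eml_mul_sub_mean_mul_le)
open Summit.QuantumFields.YangMills.Theorems.Prop7FrameLevelOnto (mul_meanCLM_mul transl_emb_disp_stairWord_eq_blockSite)
open Summit.QuantumFields.YangMills.Theorems.Prop8Chart (emlIterU)
open B15DeterminingSets (embIter)

variable {𝔸 : Type*} [NormedRing 𝔸] [NormedAlgebra ℂ 𝔸] [CompleteSpace 𝔸]

/-! ## §1 Normed-algebra letters: conjugation by contractive units, the arithmetic mean -/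

section Letters

variable {ι : Type*} [Fintype ι]

omit [NormedAlgebra ℂ 𝔸] [CompleteSpace 𝔸] in
/-- conjugation by a unit with `‖u‖, ‖u⁻¹‖ ≤ 1` does not increase the norm. [folklore] -/
theorem norm_conj_le_of_norm_le_one (u : 𝔸ˣ) (hu : ‖(u : 𝔸)‖ ≤ 1) (hu' : ‖((u⁻¹ : 𝔸ˣ) : 𝔸)‖ ≤ 1) (c : 𝔸) :
    ‖(u : 𝔸) * c * ((u⁻¹ : 𝔸ˣ) : 𝔸)‖ ≤ ‖c‖ := by
  calc ‖(u : 𝔸) * c * ((u⁻¹ : 𝔸ˣ) : 𝔸)‖ ≤ ‖(u : 𝔸)‖ * ‖c‖ * ‖((u⁻¹ : 𝔸ˣ) : 𝔸)‖ :=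
        (norm_mul_le _ _).trans (mul_le_mul_of_nonneg_right (norm_mul_le _ _) (norm_nonneg _))
    _ ≤ 1 * ‖c‖ * 1 := by gcongr
    _ = ‖c‖ := by ring

omit [NormedAlgebra ℂ 𝔸] [CompleteSpace 𝔸] in
/-- two contractive conjugations differ by at most twice the distance of the units: `‖u c u⁻¹ − v c v⁻¹‖ ≤ 2‖u − v‖·‖c‖`. [folklore] -/
theorem norm_conj_sub_conj_le_of_norm_le_one (u v : 𝔸ˣ) (hu' : ‖((u⁻¹ : 𝔸ˣ) : 𝔸)‖ ≤ 1) (hv : ‖(v : 𝔸)‖ ≤ 1) (hv' : ‖((v⁻¹ : 𝔸ˣ) : 𝔸)‖ ≤ 1)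
    (c : 𝔸) : ‖(u : 𝔸) * c * ((u⁻¹ : 𝔸ˣ) : 𝔸) - (v : 𝔸) * c * ((v⁻¹ : 𝔸ˣ) : 𝔸)‖ ≤ 2 * ‖(u : 𝔸) - v‖ * ‖c‖ := by
  have hinv : ((u⁻¹ : 𝔸ˣ) : 𝔸) - ((v⁻¹ : 𝔸ˣ) : 𝔸) = ((u⁻¹ : 𝔸ˣ) : 𝔸) * ((v : 𝔸) - u) * ((v⁻¹ : 𝔸ˣ) : 𝔸) := by
    rw [mul_sub, sub_mul, Units.inv_mul, one_mul, mul_assoc, Units.mul_inv, mul_one]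
  have hinv' : ‖((u⁻¹ : 𝔸ˣ) : 𝔸) - ((v⁻¹ : 𝔸ˣ) : 𝔸)‖ ≤ ‖(u : 𝔸) - v‖ := by
    rw [hinv]
    calc ‖((u⁻¹ : 𝔸ˣ) : 𝔸) * ((v : 𝔸) - u) * ((v⁻¹ : 𝔸ˣ) : 𝔸)‖ ≤ ‖((u⁻¹ : 𝔸ˣ) : 𝔸)‖ * ‖(v : 𝔸) - u‖ * ‖((v⁻¹ : 𝔸ˣ) : 𝔸)‖ :=
          (norm_mul_le _ _).trans (mul_le_mul_of_nonneg_right (norm_mul_le _ _) (norm_nonneg _))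
      _ ≤ 1 * ‖(v : 𝔸) - u‖ * 1 := by gcongr
      _ = ‖(u : 𝔸) - v‖ := by rw [one_mul, mul_one, norm_sub_rev]
  have heq : (u : 𝔸) * c * ((u⁻¹ : 𝔸ˣ) : 𝔸) - (v : 𝔸) * c * ((v⁻¹ : 𝔸ˣ) : 𝔸)
      = ((u : 𝔸) - v) * c * ((u⁻¹ : 𝔸ˣ) : 𝔸) + (v : 𝔸) * c * (((u⁻¹ : 𝔸ˣ) : 𝔸) - ((v⁻¹ : 𝔸ˣ) : 𝔸)) := by noncomm_ring
  rw [heq]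
  calc ‖((u : 𝔸) - v) * c * ((u⁻¹ : 𝔸ˣ) : 𝔸) + (v : 𝔸) * c * (((u⁻¹ : 𝔸ˣ) : 𝔸) - ((v⁻¹ : 𝔸ˣ) : 𝔸))‖
      ≤ ‖((u : 𝔸) - v) * c * ((u⁻¹ : 𝔸ˣ) : 𝔸)‖ + ‖(v : 𝔸) * c * (((u⁻¹ : 𝔸ˣ) : 𝔸) - ((v⁻¹ : 𝔸ˣ) : 𝔸))‖ := norm_add_le _ _
    _ ≤ ‖(u : 𝔸) - v‖ * ‖c‖ * ‖((u⁻¹ : 𝔸ˣ) : 𝔸)‖ + ‖(v : 𝔸)‖ * ‖c‖ * ‖((u⁻¹ : 𝔸ˣ) : 𝔸) - ((v⁻¹ : 𝔸ˣ) : 𝔸)‖ := by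
        gcongr
        · exact (norm_mul_le _ _).trans (mul_le_mul_of_nonneg_right (norm_mul_le _ _) (norm_nonneg _))
        · exact (norm_mul_le _ _).trans (mul_le_mul_of_nonneg_right (norm_mul_le _ _) (norm_nonneg _))
    _ ≤ ‖(u : 𝔸) - v‖ * ‖c‖ * 1 + 1 * ‖c‖ * ‖(u : 𝔸) - v‖ := by gcongr
    _ = 2 * ‖(u : 𝔸) - v‖ * ‖c‖ := by ring

omit [NormedAlgebra ℂ 𝔸] [CompleteSpace 𝔸] in
/-- the framed transporter against the background one: `‖ν₀·P·ν⁻¹ − Q₀‖ ≤ ‖ν₀ − 1‖ + ‖P − Q₀‖ + ‖ν⁻¹ − 1‖` for contractive `P`, `ν⁻¹`, `Q₀`. [folklore] -/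
theorem norm_frame_mul_mul_inv_sub_le (ν₀ ν P Q₀ : 𝔸ˣ) (hP : ‖(P : 𝔸)‖ ≤ 1) (hν' : ‖((ν⁻¹ : 𝔸ˣ) : 𝔸)‖ ≤ 1) (hQ₀ : ‖(Q₀ : 𝔸)‖ ≤ 1) :
    ‖((ν₀ * P * ν⁻¹ : 𝔸ˣ) : 𝔸) - Q₀‖ ≤ ‖(ν₀ : 𝔸) - 1‖ + ‖(P : 𝔸) - Q₀‖ + ‖((ν⁻¹ : 𝔸ˣ) : 𝔸) - 1‖ := by
  have heq : ((ν₀ * P * ν⁻¹ : 𝔸ˣ) : 𝔸) - Q₀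
      = ((ν₀ : 𝔸) - 1) * P * ((ν⁻¹ : 𝔸ˣ) : 𝔸) + ((P : 𝔸) - Q₀) * ((ν⁻¹ : 𝔸ˣ) : 𝔸) + (Q₀ : 𝔸) * (((ν⁻¹ : 𝔸ˣ) : 𝔸) - 1) := by
    simp only [Units.val_mul]; noncomm_ring
  rw [heq]
  calc ‖((ν₀ : 𝔸) - 1) * P * ((ν⁻¹ : 𝔸ˣ) : 𝔸) + ((P : 𝔸) - Q₀) * ((ν⁻¹ : 𝔸ˣ) : 𝔸) + (Q₀ : 𝔸) * (((ν⁻¹ : 𝔸ˣ) : 𝔸) - 1)‖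
      ≤ ‖((ν₀ : 𝔸) - 1) * P * ((ν⁻¹ : 𝔸ˣ) : 𝔸)‖ + ‖((P : 𝔸) - Q₀) * ((ν⁻¹ : 𝔸ˣ) : 𝔸)‖ + ‖(Q₀ : 𝔸) * (((ν⁻¹ : 𝔸ˣ) : 𝔸) - 1)‖ :=
        norm_add₃_le
    _ ≤ ‖(ν₀ : 𝔸) - 1‖ * ‖(P : 𝔸)‖ * ‖((ν⁻¹ : 𝔸ˣ) : 𝔸)‖ + ‖(P : 𝔸) - Q₀‖ * ‖((ν⁻¹ : 𝔸ˣ) : 𝔸)‖ + ‖(Q₀ : 𝔸)‖ * ‖((ν⁻¹ : 𝔸ˣ) : 𝔸) - 1‖ := by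
        gcongr
        · exact (norm_mul_le _ _).trans (mul_le_mul_of_nonneg_right (norm_mul_le _ _) (norm_nonneg _))
        · exact norm_mul_le _ _
        · exact norm_mul_le _ _
    _ ≤ ‖(ν₀ : 𝔸) - 1‖ * 1 * 1 + ‖(P : 𝔸) - Q₀‖ * 1 + 1 * ‖((ν⁻¹ : 𝔸ˣ) : 𝔸) - 1‖ := by gcongr
    _ = ‖(ν₀ : 𝔸) - 1‖ + ‖(P : 𝔸) - Q₀‖ + ‖((ν⁻¹ : 𝔸ˣ) : 𝔸) - 1‖ := by ring

omit [CompleteSpace 𝔸] in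
/-- the arithmetic mean is bounded by the mean of the norms. [folklore] -/
theorem norm_meanCLM_le_mean_norm (f : ι → 𝔸) : ‖meanCLM ι 𝔸 f‖ ≤ (Fintype.card ι : ℝ)⁻¹ * ∑ i, ‖f i‖ := by
  rw [meanCLM_apply, norm_smul, norm_inv, Complex.norm_natCast]
  exact mul_le_mul_of_nonneg_left (norm_sum_le _ _) (by positivity)

end Letters

/-! ## §2 The one-level step of the frame-corrected operator against the background `Ad`-average (abstract index set) -/

section Core

variable {ι : Type*} [Fintype ι] [Nonempty ι]

/-- ★★ **ONE LEVEL OF `𝓚_{A₁} − 𝓚₀`, ABSTRACTLY.**  Index set `ι` (in the tower: `Idx P`), transporters `τ` with `‖τ − 1‖ ≤ δτ ≤ 1∕24`, one-level frame `w = eml τ`, centre frame `ν₀`,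
child frames `ν_i`, moving stair holonomies `P_i`, background stair holonomies `Q₀_i`, all CONTRACTIVE units (`‖u^{±1}‖ ≤ 1`; at T³: `SU(2)`), closeness `‖ν₀ − 1‖, ‖ν_i⁻¹ − 1‖ ≤ δν`,
`‖P_i − Q₀_i‖ ≤ δP`; centre value `a`, child values `b_i` (both of norm `≤ A`), background child values `b₀_i`.  Then FR₁'s successor value
`a − ν₀·D eml(τ)(σ·τ)·w⁻¹·ν₀⁻¹`, `σ_i = Ad_{ν₀⁻¹}a − Ad_{P_iν_i⁻¹}b_i`, differs from the background successor `mean_i Ad_{Q₀_i} b₀_i` by at most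
**`mean_i ‖b_i − b₀_i‖ + 2(2δν + δP)·mean_i ‖b_i‖ + 326·A·δτ`**: exactly, `a − ν₀·D·w⁻¹·ν₀⁻¹ = mean_i Ad_{ν₀P_iν_i⁻¹} b_i − Ad_{ν₀}(E·w⁻¹)` with FR₁ §5's defect
`E = D eml(τ)(σ·τ) − (mean σ)·eml τ`, `‖E‖ ≤ 163‖σ‖_∞‖τ − 1‖` (✓`norm_fderiv_eml_mul_sub_mean_mul_le`), `‖σ‖_∞ ≤ 2A`; the `Ad`-terms are compared unit by unit (§1).
[cite: Balaban1985Averaging, (82) p.30, (97) p.32, (89)-(92) p.31; Balaban1985BackgroundPropagators, (3.19) p.393] -/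
theorem norm_levelStep_sub_mean_le (τ : ι → 𝔸) {δτ : ℝ} (hδτ : δτ ≤ 1 / 24) (hτ : ‖τ - 1‖ ≤ δτ)
    (ν₀ w : 𝔸ˣ) (ν P Q₀ : ι → 𝔸ˣ) (hw : (w : 𝔸) = eml τ)
    (hν₀ : ‖(ν₀ : 𝔸)‖ ≤ 1) (hν₀' : ‖((ν₀⁻¹ : 𝔸ˣ) : 𝔸)‖ ≤ 1) (hw' : ‖((w⁻¹ : 𝔸ˣ) : 𝔸)‖ ≤ 1)
    (hν : ∀ i, ‖(ν i : 𝔸)‖ ≤ 1) (hν' : ∀ i, ‖(((ν i)⁻¹ : 𝔸ˣ) : 𝔸)‖ ≤ 1)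
    (hP : ∀ i, ‖(P i : 𝔸)‖ ≤ 1) (hP' : ∀ i, ‖(((P i)⁻¹ : 𝔸ˣ) : 𝔸)‖ ≤ 1)
    (hQ₀ : ∀ i, ‖(Q₀ i : 𝔸)‖ ≤ 1) (hQ₀' : ∀ i, ‖(((Q₀ i)⁻¹ : 𝔸ˣ) : 𝔸)‖ ≤ 1)
    {δν δP : ℝ} (hν₀1 : ‖(ν₀ : 𝔸) - 1‖ ≤ δν) (hν1 : ∀ i, ‖(((ν i)⁻¹ : 𝔸ˣ) : 𝔸) - 1‖ ≤ δν) (hPQ : ∀ i, ‖(P i : 𝔸) - Q₀ i‖ ≤ δP)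
    (a : 𝔸) (b b₀ : ι → 𝔸) {A : ℝ} (ha : ‖a‖ ≤ A) (hb : ∀ i, ‖b i‖ ≤ A) :
    ‖(a - (ν₀ : 𝔸) * fderiv ℂ (eml : (ι → 𝔸) → 𝔸) τ
          (fun i => (((ν₀⁻¹ : 𝔸ˣ) : 𝔸) * a * ν₀ - (P i : 𝔸) * ((((ν i)⁻¹ : 𝔸ˣ) : 𝔸) * b i * ν i) * (((P i)⁻¹ : 𝔸ˣ) : 𝔸)) * τ i) *
          ((w⁻¹ : 𝔸ˣ) : 𝔸) * ((ν₀⁻¹ : 𝔸ˣ) : 𝔸))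
      - meanCLM ι 𝔸 (fun i => (Q₀ i : 𝔸) * b₀ i * (((Q₀ i)⁻¹ : 𝔸ˣ) : 𝔸))‖
      ≤ (Fintype.card ι : ℝ)⁻¹ * ∑ i, ‖b i - b₀ i‖ + 2 * (2 * δν + δP) * ((Fintype.card ι : ℝ)⁻¹ * ∑ i, ‖b i‖) + 326 * A * δτ := by
  -- letters
  set σ : ι → 𝔸 := fun i => ((ν₀⁻¹ : 𝔸ˣ) : 𝔸) * a * ν₀ - (P i : 𝔸) * ((((ν i)⁻¹ : 𝔸ˣ) : 𝔸) * b i * ν i) * (((P i)⁻¹ : 𝔸ˣ) : 𝔸) with hσ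
  have hστ : (fun i => (((ν₀⁻¹ : 𝔸ˣ) : 𝔸) * a * ν₀ - (P i : 𝔸) * ((((ν i)⁻¹ : 𝔸ˣ) : 𝔸) * b i * ν i) * (((P i)⁻¹ : 𝔸ˣ) : 𝔸)) * τ i) = σ * τ :=
    funext fun _ => rfl
  rw [hστ]
  set Q : ι → 𝔸ˣ := fun i => ν₀ * P i * (ν i)⁻¹ with hQ
  set D : 𝔸 := fderiv ℂ (eml : (ι → 𝔸) → 𝔸) τ (σ * τ) with hD
  set E : 𝔸 := D - meanCLM ι 𝔸 σ * eml τ with hE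
  -- the size of `σ` and FR₁ §5
  have hA0 : 0 ≤ A := (norm_nonneg a).trans ha
  have hσi : ∀ i, ‖σ i‖ ≤ 2 * A := by
    intro i
    have h1 : ‖((ν₀⁻¹ : 𝔸ˣ) : 𝔸) * a * ν₀‖ ≤ ‖a‖ := by
      have := norm_conj_le_of_norm_le_one ν₀⁻¹ hν₀' (by rw [inv_inv]; exact hν₀) a
      rw [inv_inv] at this; exact this
    have h2 : ‖(P i : 𝔸) * ((((ν i)⁻¹ : 𝔸ˣ) : 𝔸) * b i * ν i) * (((P i)⁻¹ : 𝔸ˣ) : 𝔸)‖ ≤ ‖b i‖ := by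
      refine (norm_conj_le_of_norm_le_one (P i) (hP i) (hP' i) _).trans ?_
      have := norm_conj_le_of_norm_le_one (ν i)⁻¹ (hν' i) (by rw [inv_inv]; exact hν i) (b i)
      rw [inv_inv] at this; exact this
    calc ‖σ i‖ ≤ ‖((ν₀⁻¹ : 𝔸ˣ) : 𝔸) * a * ν₀‖ + ‖(P i : 𝔸) * ((((ν i)⁻¹ : 𝔸ˣ) : 𝔸) * b i * ν i) * (((P i)⁻¹ : 𝔸ˣ) : 𝔸)‖ := norm_sub_le _ _
      _ ≤ ‖a‖ + ‖b i‖ := add_le_add h1 h2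
      _ ≤ A + A := add_le_add ha (hb i)
      _ = 2 * A := by ring
  have hσn : ‖σ‖ ≤ 2 * A := (pi_norm_le_iff_of_nonneg (by linarith)).2 hσi
  have hEb : ‖E‖ ≤ 326 * A * δτ := by
    have hδτ0 : 0 ≤ δτ := (norm_nonneg _).trans hτ
    calc ‖E‖ ≤ 163 * ‖σ‖ * ‖τ - 1‖ := norm_fderiv_eml_mul_sub_mean_mul_le (hτ.trans hδτ) σ
      _ ≤ 163 * (2 * A) * δτ := by gcongr
      _ = 326 * A * δτ := by ring
  -- the exact identity `a − ν₀·D·w⁻¹·ν₀⁻¹ = mean_i Ad_{Q_i} b_i − Ad_{ν₀}(E·w⁻¹)`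
  have hDw : D = meanCLM ι 𝔸 σ * (w : 𝔸) + E := by rw [hE, hw]; abel
  have hkey : a - (ν₀ : 𝔸) * D * ((w⁻¹ : 𝔸ˣ) : 𝔸) * ((ν₀⁻¹ : 𝔸ˣ) : 𝔸)
      = meanCLM ι 𝔸 (fun i => (Q i : 𝔸) * b i * (((Q i)⁻¹ : 𝔸ˣ) : 𝔸)) - (ν₀ : 𝔸) * E * ((w⁻¹ : 𝔸ˣ) : 𝔸) * ((ν₀⁻¹ : 𝔸ˣ) : 𝔸) := by
    have h1 : (ν₀ : 𝔸) * D * ((w⁻¹ : 𝔸ˣ) : 𝔸) * ((ν₀⁻¹ : 𝔸ˣ) : 𝔸)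
        = (ν₀ : 𝔸) * meanCLM ι 𝔸 σ * ((ν₀⁻¹ : 𝔸ˣ) : 𝔸) + (ν₀ : 𝔸) * E * ((w⁻¹ : 𝔸ˣ) : 𝔸) * ((ν₀⁻¹ : 𝔸ˣ) : 𝔸) := by
      rw [hDw]
      simp only [mul_add, add_mul, mul_assoc, Units.mul_inv_cancel_left]
    have h2 : (ν₀ : 𝔸) * meanCLM ι 𝔸 σ * ((ν₀⁻¹ : 𝔸ˣ) : 𝔸)
        = meanCLM ι 𝔸 (fun i => a - (Q i : 𝔸) * b i * (((Q i)⁻¹ : 𝔸ˣ) : 𝔸)) := by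
      rw [mul_meanCLM_mul]
      congr 1; funext i
      simp only [hσ, hQ, mul_sub, sub_mul, mul_inv_rev, inv_inv, Units.val_mul, mul_assoc, Units.mul_inv_cancel_left, Units.mul_inv, mul_one]
    have h3 : meanCLM ι 𝔸 (fun i => a - (Q i : 𝔸) * b i * (((Q i)⁻¹ : 𝔸ˣ) : 𝔸))
        = a - meanCLM ι 𝔸 (fun i => (Q i : 𝔸) * b i * (((Q i)⁻¹ : 𝔸ˣ) : 𝔸)) := by
      have : (fun i => a - (Q i : 𝔸) * b i * (((Q i)⁻¹ : 𝔸ˣ) : 𝔸)) = (fun _ : ι => a) - fun i => (Q i : 𝔸) * b i * (((Q i)⁻¹ : 𝔸ˣ) : 𝔸) := rfl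
      have hc : meanCLM ι 𝔸 (fun _ : ι => a) = a := by
        rw [meanCLM_apply, Finset.sum_const, Finset.card_univ, ← Nat.cast_smul_eq_nsmul ℂ, smul_smul,
          inv_mul_cancel₀ (Nat.cast_ne_zero.2 Fintype.card_ne_zero), one_smul]
      rw [this, map_sub, hc]
    rw [h1, h2, h3]; abel
  have hkey' : a - (ν₀ : 𝔸) * D * ((w⁻¹ : 𝔸ˣ) : 𝔸) * ((ν₀⁻¹ : 𝔸ˣ) : 𝔸) - meanCLM ι 𝔸 (fun i => (Q₀ i : 𝔸) * b₀ i * (((Q₀ i)⁻¹ : 𝔸ˣ) : 𝔸))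
      = (meanCLM ι 𝔸 (fun i => (Q i : 𝔸) * b i * (((Q i)⁻¹ : 𝔸ˣ) : 𝔸)) - meanCLM ι 𝔸 (fun i => (Q₀ i : 𝔸) * b₀ i * (((Q₀ i)⁻¹ : 𝔸ˣ) : 𝔸)))
        - (ν₀ : 𝔸) * E * ((w⁻¹ : 𝔸ˣ) : 𝔸) * ((ν₀⁻¹ : 𝔸ˣ) : 𝔸) := by
    rw [hkey]; abel
  rw [hkey']
  -- the units `Q_i` are contractive and `(2δν + δP)`-close to `Q₀_i`
  have hQn : ∀ i, ‖(Q i : 𝔸)‖ ≤ 1 := by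
    intro i
    simp only [hQ, Units.val_mul]
    calc ‖(ν₀ : 𝔸) * P i * (((ν i)⁻¹ : 𝔸ˣ) : 𝔸)‖ ≤ ‖(ν₀ : 𝔸)‖ * ‖(P i : 𝔸)‖ * ‖(((ν i)⁻¹ : 𝔸ˣ) : 𝔸)‖ :=
          (norm_mul_le _ _).trans (mul_le_mul_of_nonneg_right (norm_mul_le _ _) (norm_nonneg _))
      _ ≤ 1 * 1 * 1 := by
          have h1 := hP i; have h2 := hν' i
          gcongr
      _ = 1 := by ring
  have hQn' : ∀ i, ‖(((Q i)⁻¹ : 𝔸ˣ) : 𝔸)‖ ≤ 1 := by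
    intro i
    simp only [hQ, mul_inv_rev, inv_inv, Units.val_mul]
    calc ‖(ν i : 𝔸) * ((((P i)⁻¹ : 𝔸ˣ) : 𝔸) * ((ν₀⁻¹ : 𝔸ˣ) : 𝔸))‖ ≤ ‖(ν i : 𝔸)‖ * (‖(((P i)⁻¹ : 𝔸ˣ) : 𝔸)‖ * ‖((ν₀⁻¹ : 𝔸ˣ) : 𝔸)‖) :=
          (norm_mul_le _ _).trans (mul_le_mul_of_nonneg_left (norm_mul_le _ _) (norm_nonneg _))
      _ ≤ 1 * (1 * 1) := by
          have h1 := hν i; have h2 := hP' i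
          gcongr
      _ = 1 := by ring
  have hQQ₀ : ∀ i, ‖(Q i : 𝔸) - Q₀ i‖ ≤ 2 * δν + δP := by
    intro i
    calc ‖(Q i : 𝔸) - Q₀ i‖ ≤ ‖(ν₀ : 𝔸) - 1‖ + ‖(P i : 𝔸) - Q₀ i‖ + ‖(((ν i)⁻¹ : 𝔸ˣ) : 𝔸) - 1‖ :=
          norm_frame_mul_mul_inv_sub_le ν₀ (ν i) (P i) (Q₀ i) (hP i) (hν' i) (hQ₀ i)
      _ ≤ δν + δP + δν := add_le_add_three hν₀1 (hPQ i) (hν1 i)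
      _ = 2 * δν + δP := by ring
  have hterm : ∀ i, ‖(Q i : 𝔸) * b i * (((Q i)⁻¹ : 𝔸ˣ) : 𝔸) - (Q₀ i : 𝔸) * b₀ i * (((Q₀ i)⁻¹ : 𝔸ˣ) : 𝔸)‖
      ≤ ‖b i - b₀ i‖ + 2 * (2 * δν + δP) * ‖b i‖ := by
    intro i
    have hsplit : (Q i : 𝔸) * b i * (((Q i)⁻¹ : 𝔸ˣ) : 𝔸) - (Q₀ i : 𝔸) * b₀ i * (((Q₀ i)⁻¹ : 𝔸ˣ) : 𝔸)
        = ((Q i : 𝔸) * b i * (((Q i)⁻¹ : 𝔸ˣ) : 𝔸) - (Q₀ i : 𝔸) * b i * (((Q₀ i)⁻¹ : 𝔸ˣ) : 𝔸))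
          + (Q₀ i : 𝔸) * (b i - b₀ i) * (((Q₀ i)⁻¹ : 𝔸ˣ) : 𝔸) := by noncomm_ring
    rw [hsplit]
    calc _ ≤ ‖(Q i : 𝔸) * b i * (((Q i)⁻¹ : 𝔸ˣ) : 𝔸) - (Q₀ i : 𝔸) * b i * (((Q₀ i)⁻¹ : 𝔸ˣ) : 𝔸)‖ + ‖(Q₀ i : 𝔸) * (b i - b₀ i) * (((Q₀ i)⁻¹ : 𝔸ˣ) : 𝔸)‖ :=
          norm_add_le _ _
      _ ≤ 2 * ‖(Q i : 𝔸) - Q₀ i‖ * ‖b i‖ + ‖b i - b₀ i‖ :=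
          add_le_add (norm_conj_sub_conj_le_of_norm_le_one (Q i) (Q₀ i) (hQn' i) (hQ₀ i) (hQ₀' i) (b i)) (norm_conj_le_of_norm_le_one (Q₀ i) (hQ₀ i) (hQ₀' i) _)
      _ ≤ 2 * (2 * δν + δP) * ‖b i‖ + ‖b i - b₀ i‖ := by gcongr; exact hQQ₀ i
      _ = ‖b i - b₀ i‖ + 2 * (2 * δν + δP) * ‖b i‖ := by ring
  have hmean : ‖meanCLM ι 𝔸 (fun i => (Q i : 𝔸) * b i * (((Q i)⁻¹ : 𝔸ˣ) : 𝔸)) - meanCLM ι 𝔸 (fun i => (Q₀ i : 𝔸) * b₀ i * (((Q₀ i)⁻¹ : 𝔸ˣ) : 𝔸))‖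
      ≤ (Fintype.card ι : ℝ)⁻¹ * ∑ i, ‖b i - b₀ i‖ + 2 * (2 * δν + δP) * ((Fintype.card ι : ℝ)⁻¹ * ∑ i, ‖b i‖) := by
    rw [← map_sub]
    refine (norm_meanCLM_le_mean_norm _).trans ?_
    have hs : ∑ i, ‖((fun i => (Q i : 𝔸) * b i * (((Q i)⁻¹ : 𝔸ˣ) : 𝔸)) - fun i => (Q₀ i : 𝔸) * b₀ i * (((Q₀ i)⁻¹ : 𝔸ˣ) : 𝔸)) i‖
        ≤ ∑ i, (‖b i - b₀ i‖ + 2 * (2 * δν + δP) * ‖b i‖) := Finset.sum_le_sum fun i _ => hterm i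
    calc (Fintype.card ι : ℝ)⁻¹ * ∑ i, ‖((fun i => (Q i : 𝔸) * b i * (((Q i)⁻¹ : 𝔸ˣ) : 𝔸)) - fun i => (Q₀ i : 𝔸) * b₀ i * (((Q₀ i)⁻¹ : 𝔸ˣ) : 𝔸)) i‖
        ≤ (Fintype.card ι : ℝ)⁻¹ * ∑ i, (‖b i - b₀ i‖ + 2 * (2 * δν + δP) * ‖b i‖) := mul_le_mul_of_nonneg_left hs (by positivity)
      _ = (Fintype.card ι : ℝ)⁻¹ * ∑ i, ‖b i - b₀ i‖ + 2 * (2 * δν + δP) * ((Fintype.card ι : ℝ)⁻¹ * ∑ i, ‖b i‖) := by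
          rw [Finset.sum_add_distrib, ← Finset.mul_sum]; ring
  have hEterm : ‖(ν₀ : 𝔸) * E * ((w⁻¹ : 𝔸ˣ) : 𝔸) * ((ν₀⁻¹ : 𝔸ˣ) : 𝔸)‖ ≤ 326 * A * δτ := by
    calc ‖(ν₀ : 𝔸) * E * ((w⁻¹ : 𝔸ˣ) : 𝔸) * ((ν₀⁻¹ : 𝔸ˣ) : 𝔸)‖ ≤ ‖(ν₀ : 𝔸)‖ * ‖E‖ * ‖((w⁻¹ : 𝔸ˣ) : 𝔸)‖ * ‖((ν₀⁻¹ : 𝔸ˣ) : 𝔸)‖ := by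
          refine (norm_mul_le _ _).trans (mul_le_mul_of_nonneg_right ?_ (norm_nonneg _))
          exact (norm_mul_le _ _).trans (mul_le_mul_of_nonneg_right (norm_mul_le _ _) (norm_nonneg _))
      _ ≤ 1 * ‖E‖ * 1 * 1 := by gcongr
      _ = ‖E‖ := by ring
      _ ≤ 326 * A * δτ := hEb
  calc _ ≤ ‖meanCLM ι 𝔸 (fun i => (Q i : 𝔸) * b i * (((Q i)⁻¹ : 𝔸ˣ) : 𝔸)) - meanCLM ι 𝔸 (fun i => (Q₀ i : 𝔸) * b₀ i * (((Q₀ i)⁻¹ : 𝔸ˣ) : 𝔸))‖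
        + ‖(ν₀ : 𝔸) * E * ((w⁻¹ : 𝔸ˣ) : 𝔸) * ((ν₀⁻¹ : 𝔸ˣ) : 𝔸)‖ := norm_sub_le _ _
    _ ≤ _ := add_le_add hmean hEterm

end Core

/-! ## §3 The tower: the nested covariant mean is dominated by any block majorant -/

section Tower

variable {P : Params}

/-- one step of the averaging sequence in MEAN form: `ns_{j+1}(y) = mean_i Ad_{Ū₀⁽ʲ⁾(Γ_{y,i})} ns_j(x_{y,i})` (the `hsucc` of ✓`hasDerivAt_frameAccU_of_avgSeq` after
`mean(c − f_i) = c − mean f`). [cite: Balaban1985Averaging, (97) p.32; Balaban1985BackgroundPropagators, (3.19) p.393] -/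
theorem avgSeq_succ_eq_mean (U₀ : GaugeField P 0 𝔸ˣ) (ns : (j : ℕ) → Site P j → 𝔸)
    (hsucc : ∀ (j : ℕ) (y : Site P (j + 1)), ns (j + 1) y = ns j (emb y) - meanCLM (Idx P) 𝔸 fun i : Idx P =>
        ns j (emb y) - ((holT (emlIterU j U₀) (emb y) (stairWord i.2.1 (off i.1)) : 𝔸ˣ) : 𝔸) * ns j (transl (emb y) (disp (stairWord i.2.1 (off i.1)))) *
          (((holT (emlIterU j U₀) (emb y) (stairWord i.2.1 (off i.1)))⁻¹ : 𝔸ˣ) : 𝔸))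
    (j : ℕ) (y : Site P (j + 1)) :
    ns (j + 1) y = meanCLM (Idx P) 𝔸 fun i : Idx P =>
      ((holT (emlIterU j U₀) (emb y) (stairWord i.2.1 (off i.1)) : 𝔸ˣ) : 𝔸) * ns j (transl (emb y) (disp (stairWord i.2.1 (off i.1)))) *
        (((holT (emlIterU j U₀) (emb y) (stairWord i.2.1 (off i.1)))⁻¹ : 𝔸ˣ) : 𝔸) := by
  rw [hsucc]
  have : (fun i : Idx P => ns j (emb y) - ((holT (emlIterU j U₀) (emb y) (stairWord i.2.1 (off i.1)) : 𝔸ˣ) : 𝔸) *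
        ns j (transl (emb y) (disp (stairWord i.2.1 (off i.1)))) * (((holT (emlIterU j U₀) (emb y) (stairWord i.2.1 (off i.1)))⁻¹ : 𝔸ˣ) : 𝔸))
      = (fun _ : Idx P => ns j (emb y)) - fun i : Idx P => ((holT (emlIterU j U₀) (emb y) (stairWord i.2.1 (off i.1)) : 𝔸ˣ) : 𝔸) *
        ns j (transl (emb y) (disp (stairWord i.2.1 (off i.1)))) * (((holT (emlIterU j U₀) (emb y) (stairWord i.2.1 (off i.1)))⁻¹ : 𝔸ˣ) : 𝔸) := rfl
  have hc : meanCLM (Idx P) 𝔸 (fun _ : Idx P => ns j (emb y)) = ns j (emb y) := by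
    rw [meanCLM_apply, Finset.sum_const, Finset.card_univ, ← Nat.cast_smul_eq_nsmul ℂ, smul_smul,
      inv_mul_cancel₀ (Nat.cast_ne_zero.2 Fintype.card_ne_zero), one_smul]
  rw [this, map_sub, hc, sub_sub_cancel]

/-- ★ **THE NESTED COVARIANT MEAN IS DOMINATED BY ANY BLOCK MAJORANT**: if `‖N x‖ ≤ R₀(x)` and the majorants are super-averaging, `mean_i R_j(x_{y,i}) ≤ R_{j+1}(y)`, and the
background stair holonomies are contractive, then `‖ns_j(z)‖ ≤ R_j(z)` at every level `j ≤ k₀` (a mean of contractive conjugates). [cite: Balaban1985Averaging, (97) p.32, (19) p.21; Balaban1984PropagatorsI, (1.16)-(1.18) p.20] -/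
theorem norm_avgSeq_le_majorant (U₀ : GaugeField P 0 𝔸ˣ) (k₀ : ℕ) {N : Site P 0 → 𝔸} (ns : (j : ℕ) → Site P j → 𝔸) (h0 : ns 0 = N)
    (hsucc : ∀ (j : ℕ) (y : Site P (j + 1)), ns (j + 1) y = ns j (emb y) - meanCLM (Idx P) 𝔸 fun i : Idx P =>
        ns j (emb y) - ((holT (emlIterU j U₀) (emb y) (stairWord i.2.1 (off i.1)) : 𝔸ˣ) : 𝔸) * ns j (transl (emb y) (disp (stairWord i.2.1 (off i.1)))) *
          (((holT (emlIterU j U₀) (emb y) (stairWord i.2.1 (off i.1)))⁻¹ : 𝔸ˣ) : 𝔸))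
    (hQ : ∀ (j : ℕ) (y : Site P (j + 1)) (i : Idx P), j < k₀ → ‖((holT (emlIterU j U₀) (emb y) (stairWord i.2.1 (off i.1)) : 𝔸ˣ) : 𝔸)‖ ≤ 1)
    (hQ' : ∀ (j : ℕ) (y : Site P (j + 1)) (i : Idx P), j < k₀ → ‖(((holT (emlIterU j U₀) (emb y) (stairWord i.2.1 (off i.1)))⁻¹ : 𝔸ˣ) : 𝔸)‖ ≤ 1)
    (R : (j : ℕ) → Site P j → ℝ) (hR0 : ∀ x, ‖N x‖ ≤ R 0 x)
    (hRmean : ∀ (j : ℕ) (y : Site P (j + 1)), j < k₀ → (Fintype.card (Idx P) : ℝ)⁻¹ * ∑ i : Idx P, R j (Site.blockSite y i.1) ≤ R (j + 1) y) :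
    ∀ (j : ℕ), j ≤ k₀ → ∀ z : Site P j, ‖ns j z‖ ≤ R j z
  | 0, _, z => by rw [h0]; exact hR0 z
  | j + 1, hj, y => by
    have hjk : j < k₀ := by omega
    rw [avgSeq_succ_eq_mean U₀ ns hsucc j y]
    refine (norm_meanCLM_le_mean_norm _).trans (le_trans ?_ (hRmean j y hjk))
    refine mul_le_mul_of_nonneg_left (Finset.sum_le_sum fun i _ => ?_) (by positivity)
    refine (norm_conj_le_of_norm_le_one _ (hQ j y i hjk) (hQ' j y i hjk) _).trans ?_
    rw [transl_emb_disp_stairWord_eq_blockSite]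
    exact norm_avgSeq_le_majorant U₀ k₀ ns h0 hsucc hQ hQ' R hR0 hRmean j (by omega) _

end Tower

end Summit.QuantumFields.YangMills.Theorems.Prop7FrameCorrectedMinusMean

end
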